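/-
Copyright (c) 2026 the pub-hodgecm-mathlib formalisation cell (harness21).  Prover seat hodgecm-mathlib-F0P2-p11 (g0) (L1; #41 TOP author K2E5-p17 (g8) desk request
2026-09-04T15:53:56Z «ONE GAP between (u-1a) and (u-1b)»), Track B «K2-LIT» ∕ hLiu418 #184♮, ROAD Φ, G5-b = Φ7-3: THE RANK-ONE (KIND 1) PACKAGES WITH A LATTICE-WEIGHTED
GROWTH — ★ (u-1a) `exists_kindOne_packages` v2, whose growth clause is stated in the input letters' weights so that ★ (u-1b) `K2LiuSiegelEisensteinRankOneMajorant` applies BY NAME.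
THEOREMS ONLY.
-/
import Summits.HodgeConjecture.HodgeConjecture.Theorems.K2LiuSiegelEisensteinRankOneTermPackageInstance   -- ★ p861563 (u-1a) (+ ★ p861061, ★ (R1-γ) §4 growth merge, heights, reference pair)
import Summits.HodgeConjecture.HodgeConjecture.Theorems.K2LiuSiegelEisensteinRankOneMajorant              -- ★ p861566 (u-1b) `rankOne_majorant∕summedGrowth_of_weightedGrowth`
import HarnessLib

/-!
# Crux `HLiu418`, socket #41, KIND 1 — v2 of ★ (u-1a): the rank-one packages `Ec₁` with `h1off`, `hd₁`, `hc₁`, `hcoef₁` AND the weighted growth letter `h1g` of ★ (u-1b),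
# from LATTICE-WEIGHTED term letters; corollary: all six kind-1 binders of the TOP's edition 3 from one summable weight

Cell `hodgecm-mathlib`, crux item hLiu418 = `stmt-HodgeConjecture-24832` (helper lane, count-neutral); squad K2 ∕ K2Liu, LEAD F0P6-plan (g14), desk = #41 TOP author K2E5-p17 (g8);
prover F0P2-p11 (g0).  THEOREMS ONLY (no `def`, no `instance`, no notation, no named-fact hypothesis, no `sorry`).

THE GAP (desk K2E5-p17 (g8) 2026-09-04T15:53:56Z).  ★ (u-1a) `K2LiuSiegelEisensteinRankOneTermPackageInstance.exists_kindOne_packages` outputs `∃ Ec₁, h1off ∧ hd₁ ∧ hc₁ ∧ hcoef₁`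
but no growth clause, while ★ (u-1b) `K2LiuSiegelEisensteinRankOneMajorant.rankOne_majorant_of_weightedGrowth` ∕ `rankOne_summedGrowth_of_weightedGrowth` (K2Liu-p25 (g0)) produce the
TOP's lattice letters `hmaj₁` ∕ `hgr₁` from a WEIGHTED growth `h1g : ‖Ec₁ S s h‖ ≤ C·w(S)·‖h‖^A` about that same — existentially bound — `Ec₁`.  This file closes the gap:
* §1 (abstract) `norm_halfShift_mul_add_le_weighted` — from `‖ρb Eb_j‖ ≤ Cb·ub·H^{Ab}`, `‖G Ea_j‖ ≤ CG·uG·H^{AG}`, `‖s − ½‖ ≤ M` and a floor `0 < m ≤ H`: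
  `‖(s − ½)ρb Eb_j + G Ea_j‖ ≤ (M·Cb·m^{Ab−A} + CG·m^{AG−A})·(ub + uG)·H^{A}`, `A = max Ab AG` (★ (R1-γ) `add_le_merged_monomial`); `norm_package_le_explicit` — then
  `‖Σ_j a_j·(…)‖ ≤ card ι·(ca·cw)·H^{Aa+Aw}`; `norm_prod_sub_le_of_dist_lt` — `‖∏_{p∈Q}(s − p)‖ ≤ ∏_{p∈Q}(‖z − p‖ + r)` on `ball z r`.
* §2 **`exists_kindOne_packages_weighted`** — ★ (u-1a)'s binders with the three monomial letters `hag ∕ hbg ∕ haG` REPLACED by their LATTICE-WEIGHTED forms (weights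
  `ua ub uG : skewMatrices → ℝ`, `0 ≤`, constants `C A r` per `z` uniform in the index `S`, a uniform bound `card (ι S) ≤ N₀`), `hRK` ∕ `hRKc` verbatim.  OUTPUT: `Ec₁` (the explicit
  formula `(∏_{p ∈ P ∖ {½}}(s − p))·Σ_j a_j·((s − ½)ρb Eb_j + G Ea_j)` on the rank-one kind, `0` off kind) with `h1off`, `hd₁`, `hc₁`, `hcoef₁` of ★ ed. 3 AND **(v) = ★ (u-1b)'s `h1g`
  BYTES at the weight `w S := ua S * (ub S + uG S)`**.
* §3 **`exists_kindOne_packages_sixLetters`** — §2 ∘ ★ (u-1b) BY NAME: with `Summable (S ↦ ua S·(ub S + uG S))` by value, `∃ Ec₁` with ALL SIX kind-1 binders `h1off hd₁ hc₁ hcoef₁ hmaj₁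
  hgr₁` of ★ `K2LiuSiegelEisensteinContinuationTopKinds.siegelEisensteinContinuation_of_kinds` (one `obtain` for edition 6).
LEFT BY VALUE (named, not dressed): the weighted term letters (TERM DATA of (R1-β)∕(R1-γ) with their lattice decay — archimedean inner-Whittaker decay in `b` for `S = b·u ⊗ ū` × ★ G7
`latticeSum_mul_detFactor_le_height`), the identification `hRK` ((R1-α) ★ p861327∕p861405 → inner line), `hRKc`, and the summability of the weight.
References: [Tan1999] §4 Prop. 4.8; [MoeglinWaldspurger1995] II.1.7, IV.1.8–IV.1.11; [KudlaRallis1994] §2; [Shimura1997] §18.5, Thm. 18.14.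
HONEST LABEL.  Count-neutral helper, hypothesis-first; `HC_CM` is proved only modulo the 7 printed citations (2 remaining named inputs: hLiu418 = `stmt-HodgeConjecture-24832`,
h413 = `stmt-HodgeConjecture-24833`) until rung 0 closes.
-/

set_option autoImplicit false
set_option linter.dupNamespace false -- the mandated namespace repeats `HodgeConjecture.HodgeConjecture`

noncomputable section

open scoped Matrix ENNReal NNReal Topology BigOperators
open NumberField IsDedekindDomain MeasureTheory MeasureTheory.Measure Filter Set Function Complex Metric
open Literature.NumberTheory.Automorphic Literature.NumberTheory.Automorphic.UnitaryGroup Literature.NumberTheory.GaloisRepresentations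
open Literature.NumberTheory.GelbartRogawski1991 Literature.NumberTheory.GelbartRogawski1991.GRConstruction
open Literature.NumberTheory.K2Lit.SiegelDoubled Literature.MeasureTheory.Group
open UnitaryDualPair

namespace Summit.HodgeConjecture.HodgeConjecture.Cruxes.HLiu418.K2LiuSiegelEisensteinRankOneTermPackageInstanceWeighted

open K2LiuSiegelUnipotentFourierDefs K2LiuUnipotentCoveringWeight K2LiuContinuityFromHalfPlane
open K2LiuRankOneInnerWhittakerContinued (add_le_merged_monomial norm_sub_half_lt)
open K2LiuContinuationPackageAlgebra (exists_height_floor)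
open K2LiuUnipotentCocompact (exists_isCompact_cover_unipDelta)
open K2LiuUnipDeltaConjMeasurePreserving (lintegral_ne_zero_of_isCoveringWeight)
open K2LiuSiegelUnipotentHaarPinned (locallyCompactSpace_unipDelta)
open K2LiuSiegelEisensteinRankOneMajorant (rankOne_majorant_of_weightedGrowth rankOne_summedGrowth_of_weightedGrowth)

/-! ## §1 The explicit arithmetic of the rank-one package, weighted -/

section Weighted

variable {X : Type*} {ι : Type*}

/-- **THE HALF-SHIFTED TERM, WEIGHTED**: `‖ρb Eb_j‖ ≤ Cb·ub·H^{Ab}`, `‖G Ea_j‖ ≤ CG·uG·H^{AG}`, `‖s − ½‖ ≤ M`, floor `0 < m ≤ H(x)`, all constants and weights `≥ 0` ⇒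
`‖(s − ½)·(ρb Eb_j) + G Ea_j‖ ≤ (M·Cb·m^{Ab−A} + CG·m^{AG−A})·(ub + uG)·H^{A}`, `A = max Ab AG` (★ (R1-γ) `add_le_merged_monomial`). [cite: MoeglinWaldspurger1995, IV.1.9] -/
theorem norm_halfShift_mul_add_le_weighted (Eb Ea : ι → ℂ → X → ℂ) (ρb G : ℂ → ℂ) {H : X → ℝ} {m : ℝ} {s : ℂ} {x : X}
    (hm : 0 < m) (hmx : m ≤ H x) {M Cb CG Ab AG ub uG : ℝ} (hsM : ‖s - 1 / 2‖ ≤ M) (hM : 0 ≤ M) (hCb : 0 ≤ Cb) (hCG : 0 ≤ CG)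
    (hub : 0 ≤ ub) (huG : 0 ≤ uG) (j : ι)
    (hb : ‖ρb s * Eb j s x‖ ≤ Cb * ub * H x ^ Ab) (hG : ‖G s * Ea j s x‖ ≤ CG * uG * H x ^ AG) :
    ‖(s - 1 / 2) * (ρb s * Eb j s x) + G s * Ea j s x‖ ≤
      (M * Cb * m ^ (Ab - max Ab AG) + CG * m ^ (AG - max Ab AG)) * (ub + uG) * H x ^ max Ab AG := by
  have hu : ‖(s - 1 / 2) * (ρb s * Eb j s x)‖ ≤ M * Cb * ub * H x ^ Ab := by
    rw [norm_mul]
    calc ‖s - 1 / 2‖ * ‖ρb s * Eb j s x‖ ≤ M * (Cb * ub * H x ^ Ab) := mul_le_mul hsM hb (norm_nonneg _) hM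
      _ = M * Cb * ub * H x ^ Ab := by ring
  have h1 := add_le_merged_monomial hm hmx (by positivity : 0 ≤ M * Cb * ub) (by positivity : 0 ≤ CG * uG) hu hG
  refine ((norm_add_le _ _).trans h1).trans ?_
  have hHA : 0 ≤ H x ^ max Ab AG := Real.rpow_nonneg (hm.le.trans hmx) _
  have he1 : 0 ≤ M * Cb * m ^ (Ab - max Ab AG) := by positivity
  have he2 : 0 ≤ CG * m ^ (AG - max Ab AG) := by positivity
  refine mul_le_mul_of_nonneg_right ?_ hHA
  nlinarith [mul_nonneg he1 huG, mul_nonneg he2 hub]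

variable [Fintype ι]

/-- **THE RANK-ONE PACKAGE FORMULA HAS EXPLICIT GROWTH**: if `‖a_j s x‖ ≤ ca·H^{Aa}` and `‖(s − ½)ρb Eb_j + G Ea_j‖ ≤ cw·H^{Aw}` (all `j`, at the given `s, x`, `H > 0`, `ca ≥ 0`)
then `‖Σ_j a_j·((s − ½)ρb Eb_j + G Ea_j)‖ ≤ card ι · (ca·cw) · H^{Aa+Aw}` (★ p861061's clause (v), exposed). [cite: MoeglinWaldspurger1995, IV.1.9] -/
theorem norm_package_le_explicit (a Eb Ea : ι → ℂ → X → ℂ) (ρb G : ℂ → ℂ) {H : X → ℝ} {s : ℂ} {x : X} (hH : 0 < H x)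
    {ca cw Aa Aw : ℝ} (hca : 0 ≤ ca) (ha : ∀ j, ‖a j s x‖ ≤ ca * H x ^ Aa) (hw : ∀ j, ‖(s - 1 / 2) * (ρb s * Eb j s x) + G s * Ea j s x‖ ≤ cw * H x ^ Aw) :
    ‖∑ j, a j s x * ((s - 1 / 2) * (ρb s * Eb j s x) + G s * Ea j s x)‖ ≤ (Fintype.card ι : ℝ) * (ca * cw) * H x ^ (Aa + Aw) := by
  have hterm : ∀ j, ‖a j s x * ((s - 1 / 2) * (ρb s * Eb j s x) + G s * Ea j s x)‖ ≤ ca * cw * H x ^ (Aa + Aw) := fun j => by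
    calc ‖a j s x * ((s - 1 / 2) * (ρb s * Eb j s x) + G s * Ea j s x)‖
        = ‖a j s x‖ * ‖(s - 1 / 2) * (ρb s * Eb j s x) + G s * Ea j s x‖ := norm_mul _ _
      _ ≤ (ca * H x ^ Aa) * (cw * H x ^ Aw) := mul_le_mul (ha j) (hw j) (norm_nonneg _) (mul_nonneg hca (Real.rpow_nonneg hH.le _))
      _ = ca * cw * (H x ^ Aa * H x ^ Aw) := by ring
      _ = ca * cw * H x ^ (Aa + Aw) := by rw [← Real.rpow_add hH]
  calc ‖∑ j, a j s x * ((s - 1 / 2) * (ρb s * Eb j s x) + G s * Ea j s x)‖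
      ≤ ∑ j, ‖a j s x * ((s - 1 / 2) * (ρb s * Eb j s x) + G s * Ea j s x)‖ := norm_sum_le _ _
    _ ≤ ∑ _j : ι, ca * cw * H x ^ (Aa + Aw) := Finset.sum_le_sum fun j _ => hterm j
    _ = (Fintype.card ι : ℝ) * (ca * cw) * H x ^ (Aa + Aw) := by rw [Finset.sum_const, Finset.card_univ, nsmul_eq_mul]; ring

omit [Fintype ι] in
/-- on `ball z r`, `‖∏_{p ∈ Q}(s − p)‖ ≤ ∏_{p ∈ Q}(‖z − p‖ + r)`. [folklore] -/
theorem norm_prod_sub_le_of_dist_lt (Q : Finset ℂ) {z s : ℂ} {r : ℝ} (hs : dist s z < r) :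
    ‖∏ p ∈ Q, (s - p)‖ ≤ ∏ p ∈ Q, (‖z - p‖ + r) := by
  rw [norm_prod]
  refine Finset.prod_le_prod (fun p _ => norm_nonneg _) fun p _ => ?_
  calc ‖s - p‖ = ‖(z - p) + (s - z)‖ := by ring_nf
    _ ≤ ‖z - p‖ + ‖s - z‖ := norm_add_le _ _
    _ ≤ ‖z - p‖ + r := by
        have : ‖s - z‖ = dist s z := (Complex.dist_eq s z).symm
        rw [this]; exact add_le_add le_rfl hs.le

end Weighted

/-! ## §2 ★ (u-1a) v2: the rank-one packages with the weighted growth letter (v) = ★ (u-1b)'s `h1g` -/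

variable (L : Type) [Field L] [NumberField L] [IsCMField L]
variable {N M n : ℕ} (e : Fin N × Fin M ≃ Fin n)
  (dV : Fin N → L) (hdV : ∀ i, IsCMField.complexConj L (dV i) = dV i)
  (dW : Fin M → L) (hdW : ∀ i, IsCMField.complexConj L (dW i) = dW i)

/-- **THE RANK-ONE (KIND 1) PACKAGES OF THE #41 TOP, v2 — WITH THE WEIGHTED GROWTH LETTER (hypothesis-first).**  Binders: as ★ (u-1a) `exists_kindOne_packages`, with `hag ∕ hbg ∕ haG`
replaced by their lattice-weighted forms (`ua ub uG ≥ 0`, constants uniform in `S`, `card (ι S) ≤ N₀`); `hRK`, `hRKc` verbatim.  Output: `Ec₁` with ★ ed. 3's `h1off`, `hd₁`, `hc₁`, `hcoef₁`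
and **(v)** = ★ (u-1b)'s `h1g` at the weight `w S := ua S * (ub S + uG S)`.
[cite: Tan1999, §4 Prop. 4.8] [cite: MoeglinWaldspurger1995, IV.1.8–IV.1.11] [cite: KudlaRallis1994, §2] [cite: Shimura1997, §18.5] -/
theorem exists_kindOne_packages_weighted (hdV0 : ∀ i, dV i ≠ 0) (hdW0 : ∀ i, dW i ≠ 0) (hn : 0 < n)
    [MeasurableSpace (unipDelta L e dV hdV dW hdW)] [BorelSpace (unipDelta L e dV hdV dW hdW)]
    (f : ℂ → HA L e dV hdV dW hdW → ℂ) (P : Finset ℂ) (hP : (1 / 2 : ℂ) ∈ P)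
    (ι : skewMatrices ((IsCMField.complexConj L : L ≃ₐ[Fp L] L) : L →+* L) ((gramR L e dV hdV dW hdW).map (algebraMap (Fp L) L)) → Type) [∀ S, Fintype (ι S)]
    (a : ∀ S, ι S → ℂ → HA L e dV hdV dW hdW → ℂ)
    (had : ∀ S j x, DifferentiableOn ℂ (fun s => a S j s x) {s : ℂ | 0 < s.re})
    (ρb ρa G : skewMatrices ((IsCMField.complexConj L : L ≃ₐ[Fp L] L) : L →+* L) ((gramR L e dV hdV dW hdW).map (algebraMap (Fp L) L)) → ℂ → ℂ)
    (hρb : ∀ S, DifferentiableOn ℂ (ρb S) {s : ℂ | 0 < s.re})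
    (hG : ∀ S, DifferentiableOn ℂ (G S) {s : ℂ | 0 < s.re}) (hGρ : ∀ S, ∀ s : ℂ, 0 < s.re → s ≠ 1 / 2 → G S s = (s - 1 / 2) * ρa S s)
    (Eb Ea : ∀ S, ι S → ℂ → HA L e dV hdV dW hdW → ℂ)
    (hEb : ∀ S j x, DifferentiableOn ℂ (fun s => Eb S j s x) {s : ℂ | 0 < s.re})
    (hEa : ∀ S j x, DifferentiableOn ℂ (fun s => Ea S j s x) {s : ℂ | 0 < s.re})
    -- THE LATTICE-WEIGHTED GROWTH LETTERS (weights by value; constants uniform in `S` near each `z`)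
    (ua ub uG : skewMatrices ((IsCMField.complexConj L : L ≃ₐ[Fp L] L) : L →+* L) ((gramR L e dV hdV dW hdW).map (algebraMap (Fp L) L)) → ℝ)
    (hua : ∀ S, 0 ≤ ua S) (hub : ∀ S, 0 ≤ ub S) (huG : ∀ S, 0 ≤ uG S) (N₀ : ℕ) (hN₀ : ∀ S, Fintype.card (ι S) ≤ N₀)
    (hag : ∀ z : ℂ, 0 < z.re → ∃ C A r : ℝ, 0 ≤ C ∧ 0 ≤ A ∧ 0 < r ∧ ∀ S j (s : ℂ), dist s z < r → ∀ x : HA L e dV hdV dW hdW,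
      ‖a S j s x‖ ≤ C * ua S * adelicHeightGL (n + n) L (x : GL (Fin (n + n)) (AdeleRing (𝓞 L) L)) ^ A)
    (hbg : ∀ z : ℂ, 0 < z.re → ∃ C A r : ℝ, 0 ≤ C ∧ 0 ≤ A ∧ 0 < r ∧ ∀ S j (s : ℂ), dist s z < r → ∀ x : HA L e dV hdV dW hdW,
      ‖ρb S s * Eb S j s x‖ ≤ C * ub S * adelicHeightGL (n + n) L (x : GL (Fin (n + n)) (AdeleRing (𝓞 L) L)) ^ A)
    (haG : ∀ z : ℂ, 0 < z.re → ∃ C A r : ℝ, 0 ≤ C ∧ 0 ≤ A ∧ 0 < r ∧ ∀ S j (s : ℂ), dist s z < r → ∀ x : HA L e dV hdV dW hdW,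
      ‖G S s * Ea S j s x‖ ≤ C * uG S * adelicHeightGL (n + n) L (x : GL (Fin (n + n)) (AdeleRing (𝓞 L) L)) ^ A)
    -- THE IDENTIFICATION LETTER and the continuity letter, on the convergence half-plane (as in ★ (u-1a))
    (hRK : ∀ S : skewMatrices ((IsCMField.complexConj L : L ≃ₐ[Fp L] L) : L →+* L) ((gramR L e dV hdV dW hdW).map (algebraMap (Fp L) L)),
      (S : Matrix (Fin n) (Fin n) L) ≠ 0 → (S : Matrix (Fin n) (Fin n) L).det = 0 →
      ∀ (νN : Measure (unipDelta L e dV hdV dW hdW)) [νN.IsHaarMeasure] (β : unipDelta L e dV hdV dW hdW → ℝ≥0∞),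
      IsCoveringWeight (unipDeltaRat L e dV hdV dW hdW) β → ∫⁻ u, β u ∂νN ≠ 0 → ∫⁻ u, β u ∂νN ≠ ∞ →
      ∀ (s : ℂ) (h : HA L e dV hdV dW hdW), (n : ℝ) / 2 < s.re →
        fourierCoeffDelta L e dV hdV dW hdW νN β (S : Matrix (Fin n) (Fin n) L) (eisensteinFamilyDelta L e dV hdV dW hdW f s) h =
          ∑ j, a S j s h * (ρb S s * Eb S j s h + ρa S s * Ea S j s h))
    (hRKc : ∀ S : skewMatrices ((IsCMField.complexConj L : L ≃ₐ[Fp L] L) : L →+* L) ((gramR L e dV hdV dW hdW).map (algebraMap (Fp L) L)),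
      ∀ (νN : Measure (unipDelta L e dV hdV dW hdW)) [νN.IsHaarMeasure] (β : unipDelta L e dV hdV dW hdW → ℝ≥0∞),
      IsCoveringWeight (unipDeltaRat L e dV hdV dW hdW) β → ∫⁻ u, β u ∂νN ≠ 0 → ∫⁻ u, β u ∂νN ≠ ∞ →
      ∀ s : ℂ, (n : ℝ) / 2 < s.re →
        Continuous fun h : HA L e dV hdV dW hdW => fourierCoeffDelta L e dV hdV dW hdW νN β (S : Matrix (Fin n) (Fin n) L) (eisensteinFamilyDelta L e dV hdV dW hdW f s) h) :
    ∃ Ec₁ : skewMatrices ((IsCMField.complexConj L : L ≃ₐ[Fp L] L) : L →+* L) ((gramR L e dV hdV dW hdW).map (algebraMap (Fp L) L)) → ℂ → HA L e dV hdV dW hdW → ℂ,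
      (∀ S : skewMatrices ((IsCMField.complexConj L : L ≃ₐ[Fp L] L) : L →+* L) ((gramR L e dV hdV dW hdW).map (algebraMap (Fp L) L)),
        ¬ ((S : Matrix (Fin n) (Fin n) L) ≠ 0 ∧ (S : Matrix (Fin n) (Fin n) L).det = 0) → ∀ s h, Ec₁ S s h = 0) ∧
      (∀ (S : skewMatrices ((IsCMField.complexConj L : L ≃ₐ[Fp L] L) : L →+* L) ((gramR L e dV hdV dW hdW).map (algebraMap (Fp L) L))) (h : HA L e dV hdV dW hdW),
        DifferentiableOn ℂ (fun s => Ec₁ S s h) {s : ℂ | 0 < s.re}) ∧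
      (∀ (S : skewMatrices ((IsCMField.complexConj L : L ≃ₐ[Fp L] L) : L →+* L) ((gramR L e dV hdV dW hdW).map (algebraMap (Fp L) L))) (s : ℂ),
        0 < s.re → Continuous (Ec₁ S s)) ∧
      (∀ (νN : Measure (unipDelta L e dV hdV dW hdW)) [νN.IsHaarMeasure] (β : unipDelta L e dV hdV dW hdW → ℝ≥0∞),
        IsCoveringWeight (unipDeltaRat L e dV hdV dW hdW) β → ∫⁻ u, β u ∂νN ≠ 0 → ∫⁻ u, β u ∂νN ≠ ∞ →
        ∀ S : skewMatrices ((IsCMField.complexConj L : L ≃ₐ[Fp L] L) : L →+* L) ((gramR L e dV hdV dW hdW).map (algebraMap (Fp L) L)),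
        (S : Matrix (Fin n) (Fin n) L) ≠ 0 → (S : Matrix (Fin n) (Fin n) L).det = 0 →
        ∀ (s : ℂ) (h : HA L e dV hdV dW hdW), (n : ℝ) / 2 < s.re →
          Ec₁ S s h = (∏ p ∈ P, (s - p)) * fourierCoeffDelta L e dV hdV dW hdW νN β (S : Matrix (Fin n) (Fin n) L) (eisensteinFamilyDelta L e dV hdV dW hdW f s) h) ∧
      (∀ z : ℂ, 0 < z.re → ∃ C A r : ℝ, 0 ≤ C ∧ 0 ≤ A ∧ 0 < r ∧
        ∀ S : skewMatrices ((IsCMField.complexConj L : L ≃ₐ[Fp L] L) : L →+* L) ((gramR L e dV hdV dW hdW).map (algebraMap (Fp L) L)),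
          (S : Matrix (Fin n) (Fin n) L) ≠ 0 → (S : Matrix (Fin n) (Fin n) L).det = 0 → ∀ s : ℂ, dist s z < r → ∀ h : HA L e dV hdV dW hdW,
            ‖Ec₁ S s h‖ ≤ C * (ua S * (ub S + uG S)) * adelicHeightGL (n + n) L (h : GL (Fin (n + n)) (AdeleRing (𝓞 L) L)) ^ A) := by
  classical
  haveI : NeZero (n + n) := ⟨by omega⟩
  -- the height: positive, bounded on compacts, with a floor
  set H : HA L e dV hdV dW hdW → ℝ := fun x => adelicHeightGL (n + n) L (x : GL (Fin (n + n)) (AdeleRing (𝓞 L) L)) with hHdef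
  have hpos : ∀ x, 0 < H x := fun x => adelicHeightGL_pos_holds _
  have hcpt : ∀ K : Set (HA L e dV hdV dW hdW), IsCompact K → ∃ B : ℝ, ∀ x ∈ K, H x ≤ B := by
    intro K hK
    obtain ⟨B, -, hB⟩ := exists_adelicHeightGL_le_of_isCompact (n := n + n) (K := L) (hK.image continuous_subtype_val)
    exact ⟨B, fun x hx => hB _ (Set.mem_image_of_mem _ hx)⟩
  obtain ⟨m, hm, hfloor⟩ := exists_height_floor L e dV hdV dW hdW hn
  have hfloorH : ∀ x, m ≤ H x := fun x => hfloor x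
  -- a reference pair (as in ★ (u-1a))
  haveI : LocallyCompactSpace (unipDelta L e dV hdV dW hdW) := locallyCompactSpace_unipDelta L e dV hdV dW hdW
  haveI : Countable (unipDeltaRat L e dV hdV dW hdW) := countable_unipDeltaRat L e dV hdV dW hdW
  obtain ⟨K₀, hK₀c, hK₀cov⟩ := exists_isCompact_cover_unipDelta L e dV hdV dW hdW hdV0 hdW0
  obtain ⟨β₀, hβ₀, -, -, hβ₀top⟩ := exists_isCoveringWeight_unipDeltaRat_lintegral_ne_top L e dV hdV dW hdW (Measure.haar : Measure (unipDelta L e dV hdV dW hdW)) hK₀c hK₀cov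
  have hβ₀0 : ∫⁻ u, β₀ u ∂(Measure.haar : Measure (unipDelta L e dV hdV dW hdW)) ≠ 0 :=
    lintegral_ne_zero_of_isCoveringWeight _ (NeZero.ne _) (unipDeltaRat L e dV hdV dW hdW) hβ₀
  have hc : (1 : ℝ) / 2 ≤ (n : ℝ) / 2 := by
    have : (1 : ℝ) ≤ n := by exact_mod_cast hn
    linarith
  -- the explicit package of a rank-one index and its kind test
  let E₇ : skewMatrices ((IsCMField.complexConj L : L ≃ₐ[Fp L] L) : L →+* L) ((gramR L e dV hdV dW hdW).map (algebraMap (Fp L) L)) → ℂ → HA L e dV hdV dW hdW → ℂ :=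
    fun S s x => ∑ j, a S j s x * ((s - 1 / 2) * (ρb S s * Eb S j s x) + G S s * Ea S j s x)
  have hE₇ : ∀ S s x, E₇ S s x = ∑ j, a S j s x * ((s - 1 / 2) * (ρb S s * Eb S j s x) + G S s * Ea S j s x) := fun _ _ _ => rfl
  let rk : skewMatrices ((IsCMField.complexConj L : L ≃ₐ[Fp L] L) : L →+* L) ((gramR L e dV hdV dW hdW).map (algebraMap (Fp L) L)) → Prop :=
    fun S => (S : Matrix (Fin n) (Fin n) L) ≠ 0 ∧ (S : Matrix (Fin n) (Fin n) L).det = 0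
  -- (i) holomorphy of the explicit package
  have hE₇d : ∀ S x, DifferentiableOn ℂ (fun s => E₇ S s x) {s : ℂ | 0 < s.re} := fun S x =>
    DifferentiableOn.fun_sum fun j _ => (had S j x).mul
      (((differentiableOn_id.sub_const _).mul ((hρb S).mul (hEb S j x))).add ((hG S).mul (hEa S j x)))
  -- (iv) agreement with the reference coefficient on the convergence half-plane
  have hE₇eq : ∀ S, rk S → ∀ (s : ℂ) (x : HA L e dV hdV dW hdW), (n : ℝ) / 2 < s.re →
      E₇ S s x = (s - 1 / 2) * fourierCoeffDelta L e dV hdV dW hdW Measure.haar β₀ (S : Matrix (Fin n) (Fin n) L) (eisensteinFamilyDelta L e dV hdV dW hdW f s) x := by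
    intro S hS s x hs
    have hs0 : 0 < s.re := lt_of_le_of_lt (by positivity) hs
    have hs12 : s ≠ 1 / 2 := fun h12 => by
      have : s.re = 1 / 2 := by rw [h12]; norm_num
      linarith
    rw [hE₇, hRK S hS.1 hS.2 Measure.haar β₀ hβ₀ hβ₀0 hβ₀top s x hs, Finset.mul_sum]
    refine Finset.sum_congr rfl fun j _ => ?_
    rw [hGρ S s hs0 hs12]
    ring
  -- (v′) the weighted growth of the explicit package, uniform in `S`
  have hE₇w : ∀ z : ℂ, 0 < z.re → ∃ C A r : ℝ, 0 ≤ C ∧ 0 ≤ A ∧ 0 < r ∧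
      ∀ S (s : ℂ), dist s z < r → ∀ x, ‖E₇ S s x‖ ≤ C * (ua S * (ub S + uG S)) * H x ^ A := by
    intro z hz
    obtain ⟨Ca, Aa, ra, hCa, hAa, hra, ha⟩ := hag z hz
    obtain ⟨Cb, Ab, rb, hCb, hAb, hrb, hb⟩ := hbg z hz
    obtain ⟨CG, AG, rG, hCG, hAG, hrG, hGb⟩ := haG z hz
    set r : ℝ := min ra (min rb rG) with hr
    have hr0 : 0 < r := lt_min hra (lt_min hrb hrG)
    have hrra : r ≤ ra := min_le_left _ _
    have hrrb : r ≤ rb := (min_le_right _ _).trans (min_le_left _ _)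
    have hrrG : r ≤ rG := (min_le_right _ _).trans (min_le_right _ _)
    obtain ⟨Kw, hKw0, hKw⟩ : ∃ Kw : ℝ, 0 ≤ Kw ∧ ∀ S j (s : ℂ), dist s z < r → ∀ x,
        ‖(s - 1 / 2) * (ρb S s * Eb S j s x) + G S s * Ea S j s x‖ ≤ Kw * (ub S + uG S) * H x ^ max Ab AG := by
      have hM0 : 0 ≤ r + ‖z - 1 / 2‖ := add_nonneg hr0.le (norm_nonneg _)
      refine ⟨(r + ‖z - 1 / 2‖) * Cb * m ^ (Ab - max Ab AG) + CG * m ^ (AG - max Ab AG), by positivity, fun S j s hs x => ?_⟩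
      exact norm_halfShift_mul_add_le_weighted (Eb S) (Ea S) (ρb S) (G S) hm (hfloorH x) (norm_sub_half_lt hs).le hM0 hCb hCG (hub S) (huG S) j
        (hb S j s (hs.trans_le hrrb) x) (hGb S j s (hs.trans_le hrrG) x)
    refine ⟨(N₀ : ℝ) * (Ca * Kw), Aa + max Ab AG, r, by positivity, by positivity, hr0, fun S s hs x => ?_⟩
    have h1 := norm_package_le_explicit (a S) (Eb S) (Ea S) (ρb S) (G S) (hpos x) (mul_nonneg hCa (hua S))
      (fun j => ha S j s (hs.trans_le hrra) x) (fun j => hKw S j s hs x)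
    rw [hE₇]
    refine h1.trans ?_
    have hT : 0 ≤ Ca * ua S * (Kw * (ub S + uG S)) * H x ^ (Aa + max Ab AG) := by
      have := hua S; have := hub S; have := huG S; have := Real.rpow_nonneg (hpos x).le (Aa + max Ab AG)
      positivity
    have hcard : (Fintype.card (ι S) : ℝ) ≤ N₀ := by exact_mod_cast hN₀ S
    calc (Fintype.card (ι S) : ℝ) * (Ca * ua S * (Kw * (ub S + uG S))) * H x ^ (Aa + max Ab AG)
        = (Fintype.card (ι S) : ℝ) * ((Ca * ua S * (Kw * (ub S + uG S))) * H x ^ (Aa + max Ab AG)) := mul_assoc _ _ _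
      _ ≤ (N₀ : ℝ) * ((Ca * ua S * (Kw * (ub S + uG S))) * H x ^ (Aa + max Ab AG)) := mul_le_mul_of_nonneg_right hcard hT
      _ = (N₀ : ℝ) * (Ca * Kw) * (ua S * (ub S + uG S)) * H x ^ (Aa + max Ab AG) := by ring
  -- (ii) continuity in `x` for `0 < re s` (Vitali from (i), (v′) and `hRKc` at the reference pair)
  have hE₇c : ∀ S, rk S → ∀ s : ℂ, 0 < s.re → Continuous (E₇ S s) := by
    intro S hS s hs
    refine continuous_of_differentiableOn_halfPlane (a := 0) (c := (n : ℝ) / 2) (by positivity) (E₇ S) (hE₇d S) (fun K hK z hz => ?_) (fun s' hs' => ?_) hs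
    · obtain ⟨C, A, r, hC, hA, hr, hle⟩ := hE₇w z hz
      obtain ⟨B, hB⟩ := hcpt K hK
      have hC' : 0 ≤ C * (ua S * (ub S + uG S)) := by have := hua S; have := hub S; have := huG S; positivity
      refine ⟨C * (ua S * (ub S + uG S)) * max B 1 ^ A, r, hr, fun s' hs' x hx => (hle S s' (mem_ball.1 hs') x).trans ?_⟩
      exact mul_le_mul_of_nonneg_left (Real.rpow_le_rpow (hpos x).le ((hB x hx).trans (le_max_left _ _)) hA) hC'
    · have h1 : Continuous fun x => (s' - 1 / 2) * fourierCoeffDelta L e dV hdV dW hdW Measure.haar β₀ (S : Matrix (Fin n) (Fin n) L)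
          (eisensteinFamilyDelta L e dV hdV dW hdW f s') x := continuous_const.mul (hRKc S Measure.haar β₀ hβ₀ hβ₀0 hβ₀top s' hs')
      exact h1.congr fun x => (hE₇eq S hS s' x hs').symm
  -- THE PACKAGES
  refine ⟨fun S s h => if rk S then (∏ p ∈ P.erase (1 / 2), (s - p)) * E₇ S s h else 0, ?_, ?_, ?_, ?_, ?_⟩
  · intro S hS s h
    simp only [rk] at hS ⊢
    rw [if_neg hS]
  · intro S h
    by_cases hS : rk S
    · simp only [if_pos hS]
      exact (DifferentiableOn.fun_finsetProd fun p _ => differentiableOn_id.sub_const p).mul (hE₇d S h)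
    · simp only [if_neg hS]
      exact differentiableOn_const 0
  · intro S s hs
    by_cases hS : rk S
    · simp only [if_pos hS]
      exact continuous_const.mul (hE₇c S hS s hs)
    · simp only [if_neg hS]
      exact continuous_const
  · intro νN _ β hβ hβ0 hβtop S hS0 hSdet s h hs
    have hS : rk S := ⟨hS0, hSdet⟩
    simp only [if_pos hS]
    have hindep : fourierCoeffDelta L e dV hdV dW hdW Measure.haar β₀ (S : Matrix (Fin n) (Fin n) L) (eisensteinFamilyDelta L e dV hdV dW hdW f s) h =
        fourierCoeffDelta L e dV hdV dW hdW νN β (S : Matrix (Fin n) (Fin n) L) (eisensteinFamilyDelta L e dV hdV dW hdW f s) h := by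
      rw [hRK S hS0 hSdet Measure.haar β₀ hβ₀ hβ₀0 hβ₀top s h hs, hRK S hS0 hSdet νN β hβ hβ0 hβtop s h hs]
    rw [hE₇eq S hS s h hs, hindep, ← mul_assoc, Finset.prod_erase_mul P (fun p => s - p) hP]
  · -- (v) the weighted growth letter of ★ (u-1b)
    intro z hz
    obtain ⟨C, A, r, hC, hA, hr, hle⟩ := hE₇w z hz
    have hBP0 : 0 ≤ ∏ p ∈ P.erase (1 / 2), (‖z - p‖ + r) := Finset.prod_nonneg fun p _ => by positivity
    refine ⟨(∏ p ∈ P.erase (1 / 2), (‖z - p‖ + r)) * C, A, r, mul_nonneg hBP0 hC, hA, hr, fun S hS0 hSdet s hs h => ?_⟩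
    have hS : rk S := ⟨hS0, hSdet⟩
    show ‖(if rk S then (∏ p ∈ P.erase (1 / 2), (s - p)) * E₇ S s h else 0)‖ ≤ _
    rw [if_pos hS, norm_mul]
    calc ‖∏ p ∈ P.erase (1 / 2), (s - p)‖ * ‖E₇ S s h‖
        ≤ (∏ p ∈ P.erase (1 / 2), (‖z - p‖ + r)) * (C * (ua S * (ub S + uG S)) * H h ^ A) :=
          mul_le_mul (norm_prod_sub_le_of_dist_lt _ hs) (hle S s hs h) (norm_nonneg _) hBP0
      _ = (∏ p ∈ P.erase (1 / 2), (‖z - p‖ + r)) * C * (ua S * (ub S + uG S)) * H h ^ A := by ring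

/-! ## §3 All six kind-1 binders of the TOP from one summable weight — §2 ∘ ★ (u-1b) BY NAME -/

/-- **THE SIX KIND-1 LETTERS OF ★ ed. 3 IN ONE `obtain`**: §2's binders plus the summability of the weight `S ↦ ua S·(ub S + uG S)` BY VALUE ⇒ `∃ Ec₁` with `h1off`, `hd₁`, `hc₁`, `hcoef₁`,
`hmaj₁`, `hgr₁` of ★ `K2LiuSiegelEisensteinContinuationTopKinds.siegelEisensteinContinuation_of_kinds` — `hmaj₁`∕`hgr₁` by ★ (u-1b) `rankOne_majorant_of_weightedGrowth` ∕
`rankOne_summedGrowth_of_weightedGrowth` applied to §2's (v). [cite: Tan1999, §4 Prop. 4.8] [cite: MoeglinWaldspurger1995, II.1.7, IV.1.9–IV.1.11] [cite: KudlaRallis1994, §2] -/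
theorem exists_kindOne_packages_sixLetters (hdV0 : ∀ i, dV i ≠ 0) (hdW0 : ∀ i, dW i ≠ 0) (hn : 0 < n)
    [MeasurableSpace (unipDelta L e dV hdV dW hdW)] [BorelSpace (unipDelta L e dV hdV dW hdW)]
    (f : ℂ → HA L e dV hdV dW hdW → ℂ) (P : Finset ℂ) (hP : (1 / 2 : ℂ) ∈ P)
    (ι : skewMatrices ((IsCMField.complexConj L : L ≃ₐ[Fp L] L) : L →+* L) ((gramR L e dV hdV dW hdW).map (algebraMap (Fp L) L)) → Type) [∀ S, Fintype (ι S)]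
    (a : ∀ S, ι S → ℂ → HA L e dV hdV dW hdW → ℂ)
    (had : ∀ S j x, DifferentiableOn ℂ (fun s => a S j s x) {s : ℂ | 0 < s.re})
    (ρb ρa G : skewMatrices ((IsCMField.complexConj L : L ≃ₐ[Fp L] L) : L →+* L) ((gramR L e dV hdV dW hdW).map (algebraMap (Fp L) L)) → ℂ → ℂ)
    (hρb : ∀ S, DifferentiableOn ℂ (ρb S) {s : ℂ | 0 < s.re})
    (hG : ∀ S, DifferentiableOn ℂ (G S) {s : ℂ | 0 < s.re}) (hGρ : ∀ S, ∀ s : ℂ, 0 < s.re → s ≠ 1 / 2 → G S s = (s - 1 / 2) * ρa S s)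
    (Eb Ea : ∀ S, ι S → ℂ → HA L e dV hdV dW hdW → ℂ)
    (hEb : ∀ S j x, DifferentiableOn ℂ (fun s => Eb S j s x) {s : ℂ | 0 < s.re})
    (hEa : ∀ S j x, DifferentiableOn ℂ (fun s => Ea S j s x) {s : ℂ | 0 < s.re})
    (ua ub uG : skewMatrices ((IsCMField.complexConj L : L ≃ₐ[Fp L] L) : L →+* L) ((gramR L e dV hdV dW hdW).map (algebraMap (Fp L) L)) → ℝ)
    (hua : ∀ S, 0 ≤ ua S) (hub : ∀ S, 0 ≤ ub S) (huG : ∀ S, 0 ≤ uG S) (N₀ : ℕ) (hN₀ : ∀ S, Fintype.card (ι S) ≤ N₀)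
    (hag : ∀ z : ℂ, 0 < z.re → ∃ C A r : ℝ, 0 ≤ C ∧ 0 ≤ A ∧ 0 < r ∧ ∀ S j (s : ℂ), dist s z < r → ∀ x : HA L e dV hdV dW hdW,
      ‖a S j s x‖ ≤ C * ua S * adelicHeightGL (n + n) L (x : GL (Fin (n + n)) (AdeleRing (𝓞 L) L)) ^ A)
    (hbg : ∀ z : ℂ, 0 < z.re → ∃ C A r : ℝ, 0 ≤ C ∧ 0 ≤ A ∧ 0 < r ∧ ∀ S j (s : ℂ), dist s z < r → ∀ x : HA L e dV hdV dW hdW,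
      ‖ρb S s * Eb S j s x‖ ≤ C * ub S * adelicHeightGL (n + n) L (x : GL (Fin (n + n)) (AdeleRing (𝓞 L) L)) ^ A)
    (haG : ∀ z : ℂ, 0 < z.re → ∃ C A r : ℝ, 0 ≤ C ∧ 0 ≤ A ∧ 0 < r ∧ ∀ S j (s : ℂ), dist s z < r → ∀ x : HA L e dV hdV dW hdW,
      ‖G S s * Ea S j s x‖ ≤ C * uG S * adelicHeightGL (n + n) L (x : GL (Fin (n + n)) (AdeleRing (𝓞 L) L)) ^ A)
    (hws : Summable fun S => ua S * (ub S + uG S))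
    (hRK : ∀ S : skewMatrices ((IsCMField.complexConj L : L ≃ₐ[Fp L] L) : L →+* L) ((gramR L e dV hdV dW hdW).map (algebraMap (Fp L) L)),
      (S : Matrix (Fin n) (Fin n) L) ≠ 0 → (S : Matrix (Fin n) (Fin n) L).det = 0 →
      ∀ (νN : Measure (unipDelta L e dV hdV dW hdW)) [νN.IsHaarMeasure] (β : unipDelta L e dV hdV dW hdW → ℝ≥0∞),
      IsCoveringWeight (unipDeltaRat L e dV hdV dW hdW) β → ∫⁻ u, β u ∂νN ≠ 0 → ∫⁻ u, β u ∂νN ≠ ∞ →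
      ∀ (s : ℂ) (h : HA L e dV hdV dW hdW), (n : ℝ) / 2 < s.re →
        fourierCoeffDelta L e dV hdV dW hdW νN β (S : Matrix (Fin n) (Fin n) L) (eisensteinFamilyDelta L e dV hdV dW hdW f s) h =
          ∑ j, a S j s h * (ρb S s * Eb S j s h + ρa S s * Ea S j s h))
    (hRKc : ∀ S : skewMatrices ((IsCMField.complexConj L : L ≃ₐ[Fp L] L) : L →+* L) ((gramR L e dV hdV dW hdW).map (algebraMap (Fp L) L)),
      ∀ (νN : Measure (unipDelta L e dV hdV dW hdW)) [νN.IsHaarMeasure] (β : unipDelta L e dV hdV dW hdW → ℝ≥0∞),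
      IsCoveringWeight (unipDeltaRat L e dV hdV dW hdW) β → ∫⁻ u, β u ∂νN ≠ 0 → ∫⁻ u, β u ∂νN ≠ ∞ →
      ∀ s : ℂ, (n : ℝ) / 2 < s.re →
        Continuous fun h : HA L e dV hdV dW hdW => fourierCoeffDelta L e dV hdV dW hdW νN β (S : Matrix (Fin n) (Fin n) L) (eisensteinFamilyDelta L e dV hdV dW hdW f s) h) :
    ∃ Ec₁ : skewMatrices ((IsCMField.complexConj L : L ≃ₐ[Fp L] L) : L →+* L) ((gramR L e dV hdV dW hdW).map (algebraMap (Fp L) L)) → ℂ → HA L e dV hdV dW hdW → ℂ,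
      (∀ S : skewMatrices ((IsCMField.complexConj L : L ≃ₐ[Fp L] L) : L →+* L) ((gramR L e dV hdV dW hdW).map (algebraMap (Fp L) L)),
        ¬ ((S : Matrix (Fin n) (Fin n) L) ≠ 0 ∧ (S : Matrix (Fin n) (Fin n) L).det = 0) → ∀ s h, Ec₁ S s h = 0) ∧
      (∀ (S : skewMatrices ((IsCMField.complexConj L : L ≃ₐ[Fp L] L) : L →+* L) ((gramR L e dV hdV dW hdW).map (algebraMap (Fp L) L))) (h : HA L e dV hdV dW hdW),
        DifferentiableOn ℂ (fun s => Ec₁ S s h) {s : ℂ | 0 < s.re}) ∧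
      (∀ (S : skewMatrices ((IsCMField.complexConj L : L ≃ₐ[Fp L] L) : L →+* L) ((gramR L e dV hdV dW hdW).map (algebraMap (Fp L) L))) (s : ℂ),
        0 < s.re → Continuous (Ec₁ S s)) ∧
      (∀ (νN : Measure (unipDelta L e dV hdV dW hdW)) [νN.IsHaarMeasure] (β : unipDelta L e dV hdV dW hdW → ℝ≥0∞),
        IsCoveringWeight (unipDeltaRat L e dV hdV dW hdW) β → ∫⁻ u, β u ∂νN ≠ 0 → ∫⁻ u, β u ∂νN ≠ ∞ →
        ∀ S : skewMatrices ((IsCMField.complexConj L : L ≃ₐ[Fp L] L) : L →+* L) ((gramR L e dV hdV dW hdW).map (algebraMap (Fp L) L)),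
        (S : Matrix (Fin n) (Fin n) L) ≠ 0 → (S : Matrix (Fin n) (Fin n) L).det = 0 →
        ∀ (s : ℂ) (h : HA L e dV hdV dW hdW), (n : ℝ) / 2 < s.re →
          Ec₁ S s h = (∏ p ∈ P, (s - p)) * fourierCoeffDelta L e dV hdV dW hdW νN β (S : Matrix (Fin n) (Fin n) L) (eisensteinFamilyDelta L e dV hdV dW hdW f s) h) ∧
      (∀ z : ℂ, 0 < z.re → ∀ h₀ : HA L e dV hdV dW hdW, ∃ r > (0 : ℝ), ∃ V ∈ 𝓝 h₀,
        ∃ m : skewMatrices ((IsCMField.complexConj L : L ≃ₐ[Fp L] L) : L →+* L) ((gramR L e dV hdV dW hdW).map (algebraMap (Fp L) L)) → ℝ, Summable m ∧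
          ∀ s : ℂ, dist s z < r → ∀ h ∈ V, ∀ S, ‖Ec₁ S s h‖ ≤ m S) ∧
      (∀ z : ℂ, 0 < z.re → ∃ C A r : ℝ, 0 < r ∧ ∀ s : ℂ, dist s z < r → ∀ h : HA L e dV hdV dW hdW,
        (Summable fun S => ‖Ec₁ S s h‖) ∧ ∑' S, ‖Ec₁ S s h‖ ≤ C * adelicHeightGL (n + n) L (h : GL (Fin (n + n)) (AdeleRing (𝓞 L) L)) ^ A) := by
  obtain ⟨Ec₁, h1off, hd₁, hc₁, hcoef₁, h1g⟩ := exists_kindOne_packages_weighted L e dV hdV dW hdW hdV0 hdW0 hn f P hP ι a had ρb ρa G hρb hG hGρ Eb Ea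
    hEb hEa ua ub uG hua hub huG N₀ hN₀ hag hbg haG hRK hRKc
  have hw : ∀ S, 0 ≤ ua S * (ub S + uG S) := fun S => by have := hua S; have := hub S; have := huG S; positivity
  exact ⟨Ec₁, h1off, hd₁, hc₁, hcoef₁,
    rankOne_majorant_of_weightedGrowth L hn e dV hdV dW hdW Ec₁ h1off (fun S => ua S * (ub S + uG S)) hw hws h1g,
    rankOne_summedGrowth_of_weightedGrowth L hn e dV hdV dW hdW Ec₁ h1off (fun S => ua S * (ub S + uG S)) hw hws h1g⟩

end Summit.HodgeConjecture.HodgeConjecture.Cruxes.HLiu418.K2LiuSiegelEisensteinRankOneTermPackageInstanceWeighted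

end
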